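import Literature.MathematicalPhysics.QuantumFieldTheory.Balaban1983to89.FlowStep

/-!
# lens-2 g7 — director-ym №491 «PREDICTION made checkable», kernel part (sketch-grade; count-neutral; nothing of Bałaban's)

№491 defines the BOX door operationally: it opens iff a supply attempt sticks at a goal demanding Φ∕β at a
FOREIGN history — «a `w ∈ Box γ₀ k₁` not a prefix of the record's run».  This file types that notion over
`FlowStep` and proves the two elementary facts the prediction (LENS-2-BOX-DOOR-PARKED-491.md §2) rests on:

* `isRunPrefix_zero` — at level 0 NOTHING is foreign (every `x ∈ ]0,γ]` starts an in-window run);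
* `exists_foreign_one` — at level 1 EVERY box `]0,γ]²` (`γ > 0`) contains a foreign history, for EVERY `β`
  (the run condition (0.20) pins `g₁` given `g₀`; `(γ, γ)` and `(γ, γ∕2)` cannot both be run prefixes);
* `box_one_not_subset_runPrefixes` — hence every BOX-wide letter's level-1 clause (`BetaContH`:
  `ContinuousOn (β 1) (Box γ 1)`; `BetaUpperH`∕`BetaLowerH`; `HistLipschitz`; NE9 on `Window γ`) quantifies over
  histories that no in-window run of `β` visits.

So «the first foreign history» is at `k = 1`, and it is consumed by whichever BOX-wide letter a supplier invokes first.
HONEST: elementary real arithmetic about (0.20); K0ᴬ∕K1ᴬ∕K3ᴬ OPEN; the Yang–Mills mass gap is NOT proved.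
[cite: Balaban1987RG1, (0.20) p.256, §1 pp.263–264, Thm 3 p.264 (bookkeeping)]
-/

namespace Summit.QuantumFields.YangMills.Cruxes.Record13SepCoPHInhabited.Lens2G7.ForeignHist

open Literature.MathematicalPhysics.QuantumFieldTheory.Balaban1983to89
open Literature.MathematicalPhysics.QuantumFieldTheory.Balaban1983to89.FlowStep

/-- `v ∈ ℝ^{k+1}` is a RUN PREFIX of `β` at window `γ`: the prefix of an in-window solution of (0.20) up to `k`
(the histories the RUN door of record speaks about). [cite: Balaban1987RG1, (0.20) p.256, Thm 3 p.264] -/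
def IsRunPrefix (β : HBeta) (γ : ℝ) (k : ℕ) (v : Fin (k + 1) → ℝ) : Prop :=
  ∃ g : ℕ → ℝ, RGEqH k β g ∧ Step.InInterval γ k g ∧ prefixOf g k = v

/-- FOREIGN history (director-ym №491): in the box, but not a prefix of any in-window run of `β`. [folklore] -/
def Foreign (β : HBeta) (γ : ℝ) (k : ℕ) (v : Fin (k + 1) → ℝ) : Prop :=
  v ∈ Box γ k ∧ ¬ IsRunPrefix β γ k v

/-- Run prefixes lie in the box (so the BOX door's histories ⊇ the RUN door's). [folklore] -/
theorem IsRunPrefix.mem_box {β : HBeta} {γ : ℝ} {k : ℕ} {v : Fin (k + 1) → ℝ} (h : IsRunPrefix β γ k v) :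
    v ∈ Box γ k := by
  obtain ⟨g, -, hI, rfl⟩ := h
  rw [FlowStep.mem_box]
  intro i
  exact hI i (by have := i.isLt; omega)

/-- LEVEL 0: nothing is foreign — every `x ∈ ]0,γ]` is the start of an in-window run ((0.20) up to `0` is empty). [folklore] -/
theorem isRunPrefix_zero (β : HBeta) {γ : ℝ} {v : Fin 1 → ℝ} (hv : v ∈ Box γ 0) : IsRunPrefix β γ 0 v := by
  refine ⟨fun _ => v 0, fun k hk => absurd hk (Nat.not_lt_zero k), fun k _ => ?_, ?_⟩
  · show 0 < v 0 ∧ v 0 ≤ γ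
    exact (FlowStep.mem_box.mp hv) 0
  · funext i
    simp only [prefixOf_apply]
    exact congrArg v (Subsingleton.elim _ _)

/-- LEVEL 1: the run condition (0.20) PINS the second coupling — `1∕v₁² = 1∕v₀² − β₀(v₀)`. [cite: Balaban1987RG1, (0.20) p.256] -/
theorem inv_sq_eq_of_isRunPrefix {β : HBeta} {γ : ℝ} {v : Fin 2 → ℝ} (h : IsRunPrefix β γ 1 v) :
    1 / (v 1) ^ 2 = 1 / (v 0) ^ 2 - β 0 (fun _ => v 0) := by
  obtain ⟨g, hrg, -, hgv⟩ := h
  have h := hrg 0 Nat.zero_lt_one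
  have h0 : g 0 = v 0 := by simpa using congrFun hgv 0
  have h1 : g 1 = v 1 := by simpa using congrFun hgv 1
  have hp : prefixOf g 0 = fun _ => v 0 := by
    funext i
    rw [prefixOf_apply, ← h0]
    exact congrArg g (by have := i.isLt; omega)
  rw [hp] at h
  simp only [zero_add] at h
  rw [h0, h1] at h
  linarith

/-- ★ LEVEL 1 IS THE FIRST LEVEL WITH FOREIGN HISTORIES, FOR EVERY β: `(γ, γ)` and `(γ, γ∕2)` lie in `]0,γ]²` and cannot
both be run prefixes (they would pin the same `1∕g₁²`). [cite: Balaban1987RG1, (0.20) p.256 (elementary)] -/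
theorem exists_foreign_one (β : HBeta) {γ : ℝ} (hγ : 0 < γ) : ∃ v, Foreign β γ 1 v := by
  have hb1 : (![γ, γ] : Fin 2 → ℝ) ∈ Box γ 1 := by
    rw [FlowStep.mem_box]; intro i; fin_cases i
    · exact ⟨by simpa using hγ, by simp⟩
    · exact ⟨by simpa using hγ, by simp⟩
  have hb2 : (![γ, γ / 2] : Fin 2 → ℝ) ∈ Box γ 1 := by
    rw [FlowStep.mem_box]; intro i; fin_cases i
    · exact ⟨by simpa using hγ, by simp⟩
    · exact ⟨by simp; linarith, by simp; linarith⟩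
  by_cases h2 : IsRunPrefix β γ 1 ![γ, γ / 2]
  · by_cases h1 : IsRunPrefix β γ 1 ![γ, γ]
    · exfalso
      have e1 := inv_sq_eq_of_isRunPrefix h1
      have e2 := inv_sq_eq_of_isRunPrefix h2
      simp only [Matrix.cons_val_zero, Matrix.cons_val_one] at e1 e2
      have h4 : 1 / (γ / 2) ^ 2 = 4 * (1 / γ ^ 2) := by
        field_simp
        ring
      have hpos : 0 < 1 / γ ^ 2 := by positivity
      linarith
    · exact ⟨_, hb1, h1⟩
  · exact ⟨_, hb2, h2⟩

/-- Hence NO box of level 1 consists of run prefixes: every BOX-wide letter's `k = 1` clause (`BetaContH γ β 1`,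
`BetaUpperH`∕`BetaLowerH`, `HistLipschitz`, NE9 on `Window γ`) speaks about at least one foreign history. [folklore] -/
theorem box_one_not_subset_runPrefixes (β : HBeta) {γ : ℝ} (hγ : 0 < γ) :
    ¬ (Box γ 1 ⊆ {v | IsRunPrefix β γ 1 v}) := fun h => by
  obtain ⟨v, hv, hnot⟩ := exists_foreign_one β hγ
  exact hnot (h hv)

/-- Rule (N) non-vacuity witness: for `β ≡ 0` (constant runs `g₁ = g₀`) the history `(1, ½)` is foreign in `]0,1]²`. -/
example : Foreign (fun _ _ => 0) 1 1 ![1, 1 / 2] := by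
  refine ⟨?_, fun h => ?_⟩
  · rw [FlowStep.mem_box]; intro i; fin_cases i
    · norm_num
    · norm_num
  · have e := inv_sq_eq_of_isRunPrefix h
    simp only [Matrix.cons_val_zero, Matrix.cons_val_one] at e
    norm_num at e

end Summit.QuantumFields.YangMills.Cruxes.Record13SepCoPHInhabited.Lens2G7.ForeignHist
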